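import Mathlib.Algebra.MvPolynomial.PDeriv
import Mathlib.LinearAlgebra.Matrix.Determinant.Basic
import Mathlib.LinearAlgebra.Matrix.Block
import Literature.ModelTheory.PseudofiniteFields.EtaleOpenTopology
import HarnessLib

/-!
# Standard étale images: principal opens, translates, intersections

Topic `Literature/ModelTheory/PseudofiniteFields`.  Proof-only companion of `EtaleOpenTopology.lean`
(images `EtaleDatum.image` of standard étale data `(G_1, …, G_r ; H)` over `K^m`).  Context:
W. Johnson, C.-M. Tran, E. Walsberg, J. Ye, *The étale-open topology and the stable fields
conjecture*, J. Eur. Math. Soc. 26 (2024) [JohnsonTranWalsbergYe2024], §1 and §4: étale images form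
a basis of a topology on `𝔸^m(K)` refining the Zariski topology and invariant under affine
transformations.  The three elementary instances needed downstream are proved here by direct
computation with the definitions (no named fact is used, no new definition is made):

* `EtaleDatum.exists_image_eq_setOf_eval_ne_zero` — over a field, the principal open set `{f ≠ 0}`
  is the image of the Rabinowitsch datum `(T · f(X) − 1 ; 1)` with one auxiliary variable `T`;
  its Jacobian is `f` (`EtaleDatum.jacobianDet_mk_X_mul_sub_one`).
* `EtaleDatum.exists_image_eq_translate` — substituting `X_i ↦ X_i + v_i` (auxiliary variables
  untouched) in a datum translates its image by `-v`; the Jacobian is substituted along, by the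
  chain rule in the untouched variables (`EtaleDatum.pderiv_aeval_eq_of_forall_X`,
  `EtaleDatum.jacobianDet_mk_aeval`).
* `EtaleDatum.exists_image_eq_inter` — over a domain, concatenating two data (auxiliary variables
  `T_1, …, T_{r₁}` and `T_{r₁+1}, …, T_{r₁+r₂}`, localisation `H₁ · H₂`) realises the intersection
  of the two images: the Jacobian matrix is block diagonal
  (`EtaleDatum.submatrix_jacobiMatrix_append`), so the Jacobian determinant is the product of the
  two (`EtaleDatum.jacobianDet_mk_append`).

## Not here

Finite intersections and unions, the topology itself as a `TopologicalSpace`, functoriality under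
general polynomial maps.
-/

namespace Literature.ModelTheory.PseudofiniteFields

open MvPolynomial

namespace EtaleDatum

section CommRing

variable {K : Type*} [CommRing K] {m r r₁ r₂ : ℕ}

/-! ## Partial derivatives versus renamings and substitutions -/

/-- A renamed polynomial is killed by the partial derivative in a variable outside the range of
the renaming. [folklore] -/
theorem pderiv_rename_eq_zero_of_forall_ne {σ τ : Type*} {f : σ → τ} {z : τ} (hz : ∀ s, f s ≠ z)
    (p : MvPolynomial σ K) : pderiv z (rename f p) = 0 := by
  -- adapted from Literature.Computability.AlgebraicComplexity.pderiv_rename_eq_zero_of_forall_ne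
  induction p using MvPolynomial.induction_on with
  | C a => simp
  | add p q hp hq => simp [hp, hq]
  | mul_X p s hp => simp [hp, pderiv_X_of_ne (hz s)]

/-- **Chain rule in an untouched variable**: if `∂/∂z` commutes with the substitution
`X_s ↦ f s` on the variables, it commutes with it on all polynomials. [folklore] -/
theorem pderiv_aeval_eq_of_forall_X {σ : Type*} (f : σ → MvPolynomial σ K) (z : σ)
    (hf : ∀ s, pderiv z (f s) = aeval f (pderiv z (X s : MvPolynomial σ K)))
    (p : MvPolynomial σ K) : pderiv z (aeval f p) = aeval f (pderiv z p) := by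
  induction p using MvPolynomial.induction_on with
  | C a => simp
  | add p q hp hq => simp [hp, hq]
  | mul_X p s hp =>
    simp only [map_mul, Derivation.leibniz, smul_eq_mul, map_add, hp, aeval_X, hf]

/-- Evaluating a polynomial in the set variables only at `(x, t)` gives its value at `x`.
[folklore] -/
theorem eval_sumElim_rename_inl (x : Fin m → K) (t : Fin r → K) (f : MvPolynomial (Fin m) K) :
    eval (Sum.elim x t) (rename Sum.inl f) = eval x f := by
  rw [eval_rename, Sum.elim_comp_inl]

/-! ## Principal opens: the Rabinowitsch datum `(T · f(X) − 1 ; H)` -/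

/-- The Jacobian of the Rabinowitsch datum of `f` (one auxiliary variable `T`, equation
`T · f(X) − 1 = 0`) is `∂_T (T · f − 1) = f`. [folklore] -/
theorem jacobianDet_mk_X_mul_sub_one (f : MvPolynomial (Fin m) K)
    (H : MvPolynomial (Fin m ⊕ Fin 1) K) :
    jacobianDet (⟨fun _ => X (Sum.inr 0) * rename Sum.inl f - 1, H⟩ : EtaleDatum K m 1) =
      rename Sum.inl f := by
  rw [jacobianDet, Matrix.det_fin_one, Matrix.of_apply]
  simp [pderiv_rename_eq_zero_of_forall_ne (fun s => Sum.inl_ne_inr)]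

/-! ## Translates: substituted data -/

/-- If a substitution `X_s ↦ f s` commutes with every `∂/∂T_j`, then the Jacobian of the
substituted datum is the substituted Jacobian. [folklore] -/
theorem jacobianDet_mk_aeval (f : Fin m ⊕ Fin r → MvPolynomial (Fin m ⊕ Fin r) K)
    (hf : ∀ (j : Fin r) (p : MvPolynomial (Fin m ⊕ Fin r) K),
      pderiv (Sum.inr j) (aeval f p) = aeval f (pderiv (Sum.inr j) p))
    (D : EtaleDatum K m r) (H : MvPolynomial (Fin m ⊕ Fin r) K) :
    jacobianDet ⟨fun i => aeval f (D.G i), H⟩ = aeval f D.jacobianDet := by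
  rw [jacobianDet, jacobianDet, AlgHom.map_det, AlgHom.mapMatrix_apply]
  congr 1
  ext i j
  simp [hf]

/-- **Étale images are stable under translation**: for every datum `D` and vector `v` there is a
datum with the same number of auxiliary variables whose image is `D.image - v` — substitute
`X_i ↦ X_i + v_i`, `T_j ↦ T_j` in all polynomials of `D`. [folklore] -/
theorem exists_image_eq_translate (D : EtaleDatum K m r) (v : Fin m → K) :
    ∃ D' : EtaleDatum K m r, D'.image = {x | x + v ∈ D.image} := by
  classical
  -- the substitution `X_i ↦ X_i + v_i`, `T_j ↦ T_j`
  let f : Fin m ⊕ Fin r → MvPolynomial (Fin m ⊕ Fin r) K :=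
    Sum.elim (fun i => X (Sum.inl i) + C (v i)) (fun j => X (Sum.inr j))
  have heval : ∀ (x : Fin m → K) (t : Fin r → K) (p : MvPolynomial (Fin m ⊕ Fin r) K),
      eval (Sum.elim x t) (aeval f p) = eval (Sum.elim (x + v) t) p := by
    intro x t p
    induction p using MvPolynomial.induction_on with
    | C a => simp
    | add p q hp hq => simp [hp, hq]
    | mul_X p n hp => cases n <;> simp [hp, f]
  have hpd : ∀ (j : Fin r) (p : MvPolynomial (Fin m ⊕ Fin r) K),
      pderiv (Sum.inr j) (aeval f p) = aeval f (pderiv (Sum.inr j) p) := fun j =>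
    pderiv_aeval_eq_of_forall_X f (Sum.inr j) fun s => by
      rcases s with i | j'
      · simp [f]
      · by_cases h : j' = j
        · subst h
          simp [f]
        · simp [f, h]
  refine ⟨⟨fun i => aeval f (D.G i), aeval f D.H⟩, Set.ext fun x => ?_⟩
  rw [Set.mem_setOf_eq, mem_image_iff, mem_image_iff, jacobianDet_mk_aeval f hpd]
  simp only [heval]

/-! ## Intersections: concatenated data -/

/-- Evaluation of a first-factor polynomial at `(x, t)` only sees `t ∘ castAdd`. [folklore] -/
theorem eval_sumElim_rename_sumMap_castAdd (x : Fin m → K) (t : Fin (r₁ + r₂) → K)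
    (p : MvPolynomial (Fin m ⊕ Fin r₁) K) :
    eval (Sum.elim x t) (rename (Sum.map id (Fin.castAdd r₂)) p) =
      eval (Sum.elim x fun j => t (Fin.castAdd r₂ j)) p := by
  rw [eval_rename, Sum.elim_comp_map]
  rfl

/-- Evaluation of a second-factor polynomial at `(x, t)` only sees `t ∘ natAdd`. [folklore] -/
theorem eval_sumElim_rename_sumMap_natAdd (x : Fin m → K) (t : Fin (r₁ + r₂) → K)
    (p : MvPolynomial (Fin m ⊕ Fin r₂) K) :
    eval (Sum.elim x t) (rename (Sum.map id (Fin.natAdd r₁)) p) =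
      eval (Sum.elim x fun j => t (Fin.natAdd r₁ j)) p := by
  rw [eval_rename, Sum.elim_comp_map]
  rfl

/-- `∂/∂T_j` (`j < r₁`) commutes with the first variable embedding. [folklore] -/
theorem pderiv_inr_castAdd_rename_castAdd (j : Fin r₁) (p : MvPolynomial (Fin m ⊕ Fin r₁) K) :
    pderiv (Sum.inr (Fin.castAdd r₂ j)) (rename (Sum.map id (Fin.castAdd r₂)) p) =
      rename (Sum.map id (Fin.castAdd r₂)) (pderiv (Sum.inr j) p) :=
  pderiv_rename (Function.injective_id.sumMap (Fin.castAdd_injective _ _)) (Sum.inr j) p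

/-- `∂/∂T_{r₁ + j}` (`j < r₂`) commutes with the second variable embedding. [folklore] -/
theorem pderiv_inr_natAdd_rename_natAdd (j : Fin r₂) (p : MvPolynomial (Fin m ⊕ Fin r₂) K) :
    pderiv (Sum.inr (Fin.natAdd r₁ j)) (rename (Sum.map id (Fin.natAdd r₁)) p) =
      rename (Sum.map id (Fin.natAdd r₁)) (pderiv (Sum.inr j) p) :=
  pderiv_rename (Function.injective_id.sumMap (Fin.natAdd_injective _ _)) (Sum.inr j) p

/-- `∂/∂T_{r₁ + j}` (`j < r₂`) kills first-factor polynomials. [folklore] -/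
theorem pderiv_inr_natAdd_rename_castAdd (j : Fin r₂) (p : MvPolynomial (Fin m ⊕ Fin r₁) K) :
    pderiv (Sum.inr (Fin.natAdd r₁ j)) (rename (Sum.map id (Fin.castAdd r₂)) p) = 0 := by
  refine pderiv_rename_eq_zero_of_forall_ne (fun s => ?_) p
  rcases s with s | s
  · simp
  · simp only [Sum.map_inr, ne_eq, Sum.inr.injEq, Fin.ext_iff, Fin.val_castAdd, Fin.val_natAdd]
    omega

/-- `∂/∂T_j` (`j < r₁`) kills second-factor polynomials. [folklore] -/
theorem pderiv_inr_castAdd_rename_natAdd (j : Fin r₁) (p : MvPolynomial (Fin m ⊕ Fin r₂) K) :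
    pderiv (Sum.inr (Fin.castAdd r₂ j)) (rename (Sum.map id (Fin.natAdd r₁)) p) = 0 := by
  refine pderiv_rename_eq_zero_of_forall_ne (fun s => ?_) p
  rcases s with s | s
  · simp
  · simp only [Sum.map_inr, ne_eq, Sum.inr.injEq, Fin.ext_iff, Fin.val_castAdd, Fin.val_natAdd]
    omega

/-- **Block-diagonal Jacobian matrix**: the Jacobian matrix of the concatenated equations
(those of `D₁` in `T_1..T_{r₁}`, those of `D₂` in `T_{r₁+1}..T_{r₁+r₂}`), reindexed along
`Fin r₁ ⊕ Fin r₂ ≃ Fin (r₁ + r₂)`, is block diagonal with blocks the renamed Jacobian matrices of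
the factors. [folklore] -/
theorem submatrix_jacobiMatrix_append (D₁ : EtaleDatum K m r₁) (D₂ : EtaleDatum K m r₂) :
    (Matrix.of fun i j : Fin (r₁ + r₂) => pderiv (Sum.inr j)
        (Fin.append (fun i => rename (Sum.map id (Fin.castAdd r₂)) (D₁.G i))
          (fun i => rename (Sum.map id (Fin.natAdd r₁)) (D₂.G i)) i)).submatrix
        finSumFinEquiv finSumFinEquiv =
      Matrix.fromBlocks
        ((Matrix.of fun i j : Fin r₁ => pderiv (Sum.inr j) (D₁.G i)).map
          (rename (Sum.map id (Fin.castAdd r₂))))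
        0 0
        ((Matrix.of fun i j : Fin r₂ => pderiv (Sum.inr j) (D₂.G i)).map
          (rename (Sum.map id (Fin.natAdd r₁)))) := by
  refine Matrix.ext fun i j => ?_
  rcases i with i | i <;> rcases j with j | j
  · simp only [Matrix.submatrix_apply, finSumFinEquiv_apply_left, Matrix.of_apply,
      Fin.append_left, Matrix.fromBlocks_apply₁₁, Matrix.map_apply,
      pderiv_inr_castAdd_rename_castAdd]
  · simp only [Matrix.submatrix_apply, finSumFinEquiv_apply_left, finSumFinEquiv_apply_right,
      Matrix.of_apply, Fin.append_left, Matrix.fromBlocks_apply₁₂, Matrix.zero_apply,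
      pderiv_inr_natAdd_rename_castAdd]
  · simp only [Matrix.submatrix_apply, finSumFinEquiv_apply_left, finSumFinEquiv_apply_right,
      Matrix.of_apply, Fin.append_right, Matrix.fromBlocks_apply₂₁, Matrix.zero_apply,
      pderiv_inr_castAdd_rename_natAdd]
  · simp only [Matrix.submatrix_apply, finSumFinEquiv_apply_right, Matrix.of_apply,
      Fin.append_right, Matrix.fromBlocks_apply₂₂, Matrix.map_apply,
      pderiv_inr_natAdd_rename_natAdd]

/-- **Block-diagonal Jacobian**: the Jacobian determinant of the concatenated datum is the product
of the (renamed) Jacobian determinants of the factors. [folklore] -/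
theorem jacobianDet_mk_append (D₁ : EtaleDatum K m r₁) (D₂ : EtaleDatum K m r₂)
    (H : MvPolynomial (Fin m ⊕ Fin (r₁ + r₂)) K) :
    jacobianDet ⟨Fin.append (fun i => rename (Sum.map id (Fin.castAdd r₂)) (D₁.G i))
        (fun i => rename (Sum.map id (Fin.natAdd r₁)) (D₂.G i)), H⟩ =
      rename (Sum.map id (Fin.castAdd r₂)) D₁.jacobianDet *
        rename (Sum.map id (Fin.natAdd r₁)) D₂.jacobianDet := by
  rw [jacobianDet, ← Matrix.det_submatrix_equiv_self finSumFinEquiv,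
    submatrix_jacobiMatrix_append, Matrix.det_fromBlocks_zero₂₁, jacobianDet, jacobianDet,
    AlgHom.map_det, AlgHom.map_det, AlgHom.mapMatrix_apply, AlgHom.mapMatrix_apply]

/-- **Étale images are stable under pairwise intersection** (over a domain): the intersection of
the images of two data with `r₁` and `r₂` auxiliary variables is the image of the concatenated
datum with `r₁ + r₂` auxiliary variables (equations of both, localisation `H₁ · H₂`; witness
`t = (t₁, t₂)`). [folklore] -/
theorem exists_image_eq_inter [IsDomain K] (D₁ : EtaleDatum K m r₁) (D₂ : EtaleDatum K m r₂) :
    ∃ D : EtaleDatum K m (r₁ + r₂), D.image = D₁.image ∩ D₂.image := by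
  refine ⟨⟨Fin.append (fun i => rename (Sum.map id (Fin.castAdd r₂)) (D₁.G i))
      (fun i => rename (Sum.map id (Fin.natAdd r₁)) (D₂.G i)),
    rename (Sum.map id (Fin.castAdd r₂)) D₁.H * rename (Sum.map id (Fin.natAdd r₁)) D₂.H⟩,
    Set.ext fun x => ?_⟩
  simp only [mem_image_iff, jacobianDet_mk_append, Set.mem_inter_iff, map_mul,
    eval_sumElim_rename_sumMap_castAdd, eval_sumElim_rename_sumMap_natAdd]
  constructor
  · rintro ⟨t, hG, hH, hJ⟩
    refine ⟨⟨fun j => t (Fin.castAdd r₂ j), fun i => ?_, left_ne_zero_of_mul hH,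
      left_ne_zero_of_mul hJ⟩, ⟨fun j => t (Fin.natAdd r₁ j), fun i => ?_,
      right_ne_zero_of_mul hH, right_ne_zero_of_mul hJ⟩⟩
    · simpa [eval_sumElim_rename_sumMap_castAdd] using hG (Fin.castAdd r₂ i)
    · simpa [eval_sumElim_rename_sumMap_natAdd] using hG (Fin.natAdd r₁ i)
  · rintro ⟨⟨t₁, hG₁, hH₁, hJ₁⟩, ⟨t₂, hG₂, hH₂, hJ₂⟩⟩
    refine ⟨Fin.append t₁ t₂, fun i => ?_, ?_, ?_⟩
    · induction i using Fin.addCases with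
      | left i => simpa [eval_sumElim_rename_sumMap_castAdd] using hG₁ i
      | right i => simpa [eval_sumElim_rename_sumMap_natAdd] using hG₂ i
    · simp only [Fin.append_left, Fin.append_right]
      exact mul_ne_zero hH₁ hH₂
    · simp only [Fin.append_left, Fin.append_right]
      exact mul_ne_zero hJ₁ hJ₂

end CommRing

/-! ## Principal opens over a field -/

section Field

variable {K : Type*} [Field K] {m : ℕ}

/-- **Principal opens are étale images**: for every `f ∈ K[X_1, …, X_m]` over a field, the
principal open set `{x | f(x) ≠ 0}` is the image of the Rabinowitsch datum `(T · f(X) − 1 ; 1)`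
with one auxiliary variable (witness `t = f(x)⁻¹`). [folklore] -/
theorem exists_image_eq_setOf_eval_ne_zero (f : MvPolynomial (Fin m) K) :
    ∃ D : EtaleDatum K m 1, D.image = {x | eval x f ≠ 0} := by
  refine ⟨⟨fun _ => X (Sum.inr 0) * rename Sum.inl f - 1, 1⟩, Set.ext fun x => ?_⟩
  simp only [mem_image_iff, jacobianDet_mk_X_mul_sub_one, eval_sumElim_rename_inl,
    Set.mem_setOf_eq]
  constructor
  · rintro ⟨t, -, -, h⟩
    exact h
  · intro h
    refine ⟨fun _ => (eval x f)⁻¹, fun _ => ?_, ?_, h⟩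
    · simp [eval_sumElim_rename_inl, inv_mul_cancel₀ h]
    · simp

end Field

end EtaleDatum

end Literature.ModelTheory.PseudofiniteFields
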